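import Summits.CriticalPhenomena.PercolationContinuityZ3.Theorems.SahiPositivityWeakLimitsPi
import Summits.CriticalPhenomena.PercolationContinuityZ3.Theorems.SahiBoxTP2TiltRealSeq
import Summits.CriticalPhenomena.PercolationContinuityZ3.Theorems.SahiLiebSahiContinuumProduct

/-!
# Sahi positivity of order `n` in infinite volume is a property of the finite-dimensional marginals

Support file of the Sahi cell (`prim-sahi`, typer seat, generation 14; `--supports stmt-CriticalPhenomena-4575`).
Theorems only (no definitions, no named facts, no sorries).  The `E_n` analogue (every order `n`) of
Lindqvist 1988 Thm. 5.1 / Last–Szekli–Yogeshwaran 2020 Thm. 3.5 for positive association ("PA ⟺ all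
finite-dimensional marginals PA"; tree: `isPositivelyAssociated_pi_iff_forall_finset`), WITHOUT any box-TP₂ /
coupling hypothesis:

* `msahiE_nonneg_of_marginals_hilbertCube` — a finite measure `μ` on `[0,1]^ℕ` whose initial-segment marginals
  `μ ∘ (u ↦ u|_d)⁻¹` on `Q_d` have `E_n ≥ 0` on continuous monotone `[0,1]`-valued families (all `d`) has `E_n ≥ 0` on
  ALL measurable nonnegative monotone families of the whole configuration.  Proof: by
  `msahiE_nonneg_of_continuous_hilbertCube` continuous monotone families suffice; a continuous monotone `g` is the
  bounded pointwise limit of the cylinder families `g ∘ pad_D` (`pad_D` freezes the coordinates `≥ D` at `1`), and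
  `E_n^μ(g ∘ pad_D) = E_n^{μ_D}(g ∘ ext_D)` is a marginal quantity.
* `msahiE_nonneg_iff_marginals_hilbertCube` — hence, for measurable monotone families: positivity on `[0,1]^ℕ` ⟺
  positivity of every marginal (the converse is composition with the monotone projection).
* `msahiE_nonneg_of_marginals_realSeq` — the same on `ℝ^ℕ` (bounded families; `pad_D` freezes at `0`).

No sorries, no new axioms.
-/

noncomputable section

namespace Summit.CriticalPhenomena.PercolationContinuityZ3.Theorems.SahiWeakLimits

open MeasureTheory Set Filter Topology Function Literature.Combinatorics.Sahi2008
open Summit.CriticalPhenomena.PercolationContinuityZ3.Theorems.SahiBoxTP2 (finRestrict finExtend finExtendSeq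
  measurable_finRestrict finRestrict_apply finExtend_of_lt continuous_finExtend_one tendsto_finExtend_finRestrict
  continuous_finExtendSeq tendsto_finExtendSeq_finRestrict finExtendSeq_of_lt)
open Summit.CriticalPhenomena.PercolationContinuityZ3.Theorems (msahiE_comp_measurePreserving_of_measurable)
open scoped ENNReal unitInterval

variable {n : ℕ}

/-! ### The Hilbert cube -/

/-- `a ↦ finExtend D a 1` is monotone. [folklore] -/
theorem monotone_finExtend_one (D : ℕ) : Monotone fun a : Fin D → I => finExtend D a 1 := by
  intro a b hab i
  change finExtend D a 1 i ≤ finExtend D b 1 i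
  by_cases hi : i < D
  · rw [finExtend_of_lt _ _ hi, finExtend_of_lt _ _ hi]; exact hab _
  · simp only [finExtend, dif_neg hi]; exact le_rfl

/-- **Sahi positivity of order `n` on `[0,1]^ℕ` from the finite-dimensional marginals** (`E_n` analogue of
Lindqvist's Thm. 5.1): if every initial-segment marginal of the finite measure `μ` has `E_n ≥ 0` on continuous
monotone `[0,1]`-valued families on `Q_d`, then `E_n^μ ≥ 0` on all measurable nonnegative monotone families.
[this work] -/
theorem msahiE_nonneg_of_marginals_hilbertCube (μ : Measure (ℕ → I)) [IsFiniteMeasure μ]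
    (h : ∀ (d : ℕ) (g : Fin n → (Fin d → I) → ℝ), (∀ i, Continuous (g i)) → (∀ i, Monotone (g i)) →
      (∀ i x, 0 ≤ g i x) → (∀ i x, g i x ≤ 1) → 0 ≤ msahiE (μ.map (finRestrict d)) n g)
    (f : Fin n → (ℕ → I) → ℝ) (hfm : ∀ i, Measurable (f i)) (hf0 : ∀ i x, 0 ≤ f i x)
    (hmono : ∀ i, Monotone (f i)) : 0 ≤ msahiE μ n f := by
  refine msahiE_nonneg_of_continuous_hilbertCube μ (fun g hgc hgm hg0 hg1 => ?_) f hfm hf0 hmono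
  -- cylinder approximants `g ∘ pad_D`
  refine msahiE_nonneg_of_tendsto μ (fun D i u => g i (finExtend D (finRestrict D u) 1)) g
    (fun D i => (hgc i).measurable.comp ((continuous_finExtend_one D).measurable.comp (measurable_finRestrict D)))
    (C := 1) (fun D i u => by rw [abs_of_nonneg (hg0 i _)]; exact hg1 i _)
    (fun i u => ((hgc i).tendsto u).comp (tendsto_finExtend_finRestrict u)) fun D => ?_
  have hmp : MeasurePreserving (finRestrict D) μ (μ.map (finRestrict D)) := ⟨measurable_finRestrict D, rfl⟩
  rw [show (fun i u => g i (finExtend D (finRestrict D u) 1)) = fun i => (fun a => g i (finExtend D a 1)) ∘ finRestrict D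
    from rfl, msahiE_comp_measurePreserving_of_measurable hmp n (fun i => fun a => g i (finExtend D a 1)) fun i =>
      (hgc i).measurable.comp (continuous_finExtend_one D).measurable]
  exact h D _ (fun i => (hgc i).comp (continuous_finExtend_one D))
    (fun i a b hab => hgm i (monotone_finExtend_one D hab)) (fun i a => hg0 i _) fun i a => hg1 i _

/-- **Sahi positivity of order `n` on `[0,1]^ℕ` ⟺ Sahi positivity of every initial-segment marginal** (measurable
nonnegative monotone families on both sides). [this work] -/
theorem msahiE_nonneg_iff_marginals_hilbertCube (μ : Measure (ℕ → I)) [IsFiniteMeasure μ] :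
    (∀ f : Fin n → (ℕ → I) → ℝ, (∀ i, Measurable (f i)) → (∀ i x, 0 ≤ f i x) → (∀ i, Monotone (f i)) →
        0 ≤ msahiE μ n f) ↔
      ∀ (d : ℕ) (g : Fin n → (Fin d → I) → ℝ), (∀ i, Measurable (g i)) → (∀ i x, 0 ≤ g i x) →
        (∀ i, Monotone (g i)) → 0 ≤ msahiE (μ.map (finRestrict d)) n g := by
  constructor
  · intro hμ d g hgm hg0 hgmono
    have hmp : MeasurePreserving (finRestrict (X := I) d) μ (μ.map (finRestrict d)) := ⟨measurable_finRestrict d, rfl⟩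
    rw [← msahiE_comp_measurePreserving_of_measurable hmp n g hgm]
    exact hμ _ (fun i => (hgm i).comp (measurable_finRestrict d)) (fun i u => hg0 i _)
      fun i u v huv => hgmono i fun k => huv k
  · intro h f hfm hf0 hmono
    exact msahiE_nonneg_of_marginals_hilbertCube μ
      (fun d g hgc hgm hg0 _ => h d g (fun i => (hgc i).measurable) hg0 hgm) f hfm hf0 hmono

/-! ### Real sequences -/

/-- `a ↦ finExtendSeq D a c` is monotone. [folklore] -/
theorem monotone_finExtendSeq {X : Type*} [Preorder X] (D : ℕ) (c : ℕ → X) :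
    Monotone fun a : Fin D → X => finExtendSeq D a c := by
  intro a b hab i
  change finExtendSeq D a c i ≤ finExtendSeq D b c i
  by_cases hi : i < D
  · rw [finExtendSeq_of_lt _ _ hi, finExtendSeq_of_lt _ _ hi]; exact hab _
  · simp only [finExtendSeq, dif_neg hi]; exact le_rfl

/-- **Sahi positivity of order `n` on `ℝ^ℕ` from the finite-dimensional marginals** (bounded measurable monotone
families; the marginals are probability measures on `ℝ^d`, inner regular by compacts). [this work] -/
theorem msahiE_nonneg_of_marginals_realSeq (ν : Measure (ℕ → ℝ)) [IsProbabilityMeasure ν]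
    (h : ∀ (d : ℕ) (g : Fin n → (Fin d → ℝ) → ℝ), (∀ i, Continuous (g i)) → (∀ i, Monotone (g i)) →
      (∀ i x, 0 ≤ g i x) → (∀ i x, g i x ≤ 1) → 0 ≤ msahiE (ν.map (finRestrict d)) n g)
    (f : Fin n → (ℕ → ℝ) → ℝ) (hfm : ∀ i, Measurable (f i)) (hf0 : ∀ i x, 0 ≤ f i x) {B : ℝ}
    (hfB : ∀ i x, f i x ≤ B) (hmono : ∀ i, Monotone (f i)) : 0 ≤ msahiE ν n f := by
  refine msahiE_nonneg_of_continuous_piCountable (F := fun _ : ℕ => ℝ) (fun _ a b c hca => real_dist_sup_le a b c hca)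
    ν (fun g hgc hgm hg0 hg1 => ?_) f hfm hf0 hfB hmono
  set c : ℕ → ℝ := fun _ => 0 with hc
  refine msahiE_nonneg_of_tendsto ν (fun D i u => g i (finExtendSeq D (finRestrict D u) c)) g
    (fun D i => (hgc i).measurable.comp ((continuous_finExtendSeq D c).measurable.comp (measurable_finRestrict D)))
    (C := 1) (fun D i u => by rw [abs_of_nonneg (hg0 i _)]; exact hg1 i _)
    (fun i u => ((hgc i).tendsto u).comp (tendsto_finExtendSeq_finRestrict c u)) fun D => ?_
  have hmp : MeasurePreserving (finRestrict D) ν (ν.map (finRestrict D)) := ⟨measurable_finRestrict D, rfl⟩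
  rw [show (fun i u => g i (finExtendSeq D (finRestrict D u) c)) =
      fun i => (fun a => g i (finExtendSeq D a c)) ∘ finRestrict D from rfl,
    msahiE_comp_measurePreserving_of_measurable hmp n (fun i => fun a => g i (finExtendSeq D a c)) fun i =>
      (hgc i).measurable.comp (continuous_finExtendSeq D c).measurable]
  exact h D _ (fun i => (hgc i).comp (continuous_finExtendSeq D c))
    (fun i a b hab => hgm i (monotone_finExtendSeq D c hab)) (fun i a => hg0 i _) fun i a => hg1 i _

end Summit.CriticalPhenomena.PercolationContinuityZ3.Theorems.SahiWeakLimits
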